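/-
Copyright: public-audit package `pub-balaban` (b2b-balaban), seat pv28-g14. Released under Apache 2.0 like Mathlib.
-/
import Literature.MathematicalPhysics.QuantumFieldTheory.Balaban1983to89.T4WilsonStapleDeviation

/-!
# T4 — caveat (N1) «multi-link fibres» of the gnomonic window plug, NEGATIVE EDGE: on a fibre containing the
# STAR of a site, every gauge-invariant exponent is FLAT along the gauge orbit, so its window Hessian modulus is `≤ 0`

* Value = kernel certificate (quaternion bookkeeping + one-variable calculus); NOT summit progress; NOT continuum;
  NOT Clay.  0 [cite], 0 [model]: everything here is [folklore]; NO printed sentence is asserted and nothing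
  internally minted is cited (ABSOLUTE RULE).  Cell row T4-O3.E-iii-b-G7 (BL-window), lineage pv28, record
  `t4/T4-EST-O3Eiiib-G7.md`; this leaf types the NEGATIVE half of item (N1) of GAPS G-pv28g13-5.
* THE QUESTION (N1).  The plug `T4CubeConvexExtension.mem_respDom_of_gnoChart_local` is stated for an ARBITRARY
  finite set of links `s` (fibre `U ↦ U|ₛ` about the reference field `u₀`, gnomonic coordinates
  `x ↦ u₀(b)·P(1, x_b)`), with modulus `λ = gnoKappa S' + μ`, where `μ` is a window Hessian bound
  `hB₀ : HessianBoundOn g₀ [-S',S']ⁿ μ` of a `C²` representative `g₀` of the pulled-back exponent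
  (`agree₀ : g₀(x) = −h(u₀ ←ₛ φ(x))` on `[-S,S]ⁿ`).  The successors `T4GnomonicWilsonHessian` … `T4WilsonStapleDeviation`
  PRODUCED `μ ∝ β` — but only on ONE-LINK fibres `s = {b}` (caveat (N1) of each of them).  Can a `β`-proportional
  `μ > 0` be had on multi-link fibres?
* THE ANSWER TYPED HERE (negative edge).  NOT on any fibre `s` that contains the star of a site `x₀` (all bonds
  `b` with `b₋ = x₀` or `b₊ = x₀`; `ContainsStar s x₀`), for ANY gauge-invariant exponent `h` — in particular for
  `h = −β·A_w` (the `k = 0` Wilson exponent, every `β`, every weight `w`) and EVERY reference field `u₀`, small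
  field or not:
  (1) `updateFinset_gnoFibreChart_gaugeDir` — the straight line `τ ↦ τ•W` through the chart centre, `W = gaugeDir s u₀ e x₀ X`
      (block `R_{u₀(b)} X` on the bonds leaving `x₀`, `−X` on the bonds entering `x₀`, `0` elsewhere; `R_q` = the
      rotation `v ↦ Im(q̄ (1,v) q)` of `ℝ³`), is mapped by the fibre chart EXACTLY onto the gauge orbit
      `τ ↦ u₀^{g_τ}`, `g_τ = ` the one-site gauge transformation `x₀ ↦ P(1, τX)` (`siteTransf`); this rests on two
      quaternion identities, `g · P(1, R_{g} v) = P(1, v) · g` (`mul_gnoPoint_rotVec`) and `P(1, −v) = P(1, v)⁻¹`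
      (`gnoPoint_neg`) — one-parameter subgroups through `1` are straight rays in gnomonic coordinates;
  (2) `apply_line_eq_of_gaugeInvariant` — hence `h(u₀ ←ₛ φ(τ•W)) = h(u₀)` for all `τ`;
  (3) `fderiv_fderiv_eq_zero_of_eventually_const` — a `C²` function constant along a line near `t = 0` has
      `D²g(x)(w,w) = 0` (twice the uniqueness of derivatives; `T4CubeConvexExtension.hasDerivAt_fderiv_line` BY NAME),
      and `hessianBoundOn_nonpos_of_flat` — a window Hessian bound `μ|w|² ≤ D²g(x)(w,w)` at such a point with `w ≠ 0`
      forces `μ ≤ 0`;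
  (4) THE VERDICTS `windowModulus_nonpos_of_gaugeInvariant` (any `K ∋ 0`, any gauge-invariant `h`),
      `plug_modulus_le_of_gaugeInvariant` (in the binder shape `hS hSS' hg₀ hB₀ agree₀` of the plug: `μ ≤ 0`, so
      `λ = gnoKappa S' + μ ≤ gnoKappa S' ≤ 4` — `β`-FREE) and `plug_modulus_le_wilson` (`h = fun U => −β * wilsonAction w U`,
      via `wilsonAction_gaugeAct` = B7 (8) telescoped around (9), re-proved here for every `GaugeGroup`), and
      `globalModulus_nonpos_of_gaugeInvariant`: the GLOBAL plug `T4CubeChartGnomonic.mem_respDom_of_gnoChart`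
      (`HessianBound g₀ μ`, `μ > ½`) cannot be instantiated there at all;
  (5) `not_containsStar_singleton` — a one-link fibre never contains a star (`d ≥ 1`: the bonds `⟨x₀, e₀⟩` and
      `⟨x₀ − e₀, e₀⟩` are distinct), so the one-link results of the lineage are untouched; `containsStar_univ` — the
      full-lattice fibre contains every star (non-vacuity of the hypothesis); `two_le_card_of_containsStar`.

## Honest caveats

* WHAT THIS DOES NOT SAY.  (a) It does not say the plug fails on multi-link fibres: `λ = gnoKappa S' + μ` may still be
  positive through the Jacobian term (`gnoKappa S' > 0` for `3S'² < 1`), only WITHOUT any `β`-gain from the action.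
  (b) It does not bound `μ` on star-free multi-link fibres (e.g. a set of pairwise non-adjacent links, or the
  complement of a spanning tree) — the POSITIVE half of (N1) stays open (GAPS G-pv28g13-5).  (c) The flat direction is
  exhibited at the chart CENTRE `x = 0` only (through other chart points the orbit is a curve, not a line); that is
  all `μ ≤ 0` needs.  (d) `SU(2)` only (RANK), quaternion model `su2Quat`/`quatToSU2`.
* READING (pointer, nothing of it typed or cited here): conditional integrations in the programme under audit are
  over gauge-FIXED variables (axial gauges; cf. the tree's `B8Eq115GaugeFixing`, `T4AxialGaugeSmallField`); in a
  complete axial (maximal-tree) gauge the frozen tree touches every site, so the set of integrated links never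
  contains a full star — gauge fixing is exactly a device that avoids `ContainsStar`.  Whether and how the consumer
  lineage's fibres are gauge-fixed is consumer-side (EST in the record, nothing asserted here).
-/

noncomputable section

open scoped Quaternion Topology
open Filter

namespace Literature.MathematicalPhysics.QuantumFieldTheory.Balaban1983to89.T4WilsonGaugeFlatDirection

open Literature.MathematicalPhysics.QuantumLattice (su2Quat norm_su2Quat normSq_su2Quat quatToSU2 gnomonicQuat
  quatToSU2_su2Quat)
open Function (updateFinset)
open T4CubePoincare (cube mem_cube_iff HessianBound)
open T4CubeChartGnomonic (SU2 gnoPoint gnoChart gnoFibreChart su2Quat_gnoPoint gnoPoint_zero)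
open T4CubeConvexExtension (HessianBoundOn hessianBoundOn_iff_fderiv gnoKappa gnoKappa_eq hasDerivAt_fderiv_line
  cube_mem_nhds)
open T4HaarSU2Translate (su2Quat_mul)
open T4GnomonicWilsonHessian (imVec)
open T4WilsonLinkAffine (su2Quat_inv shift_ne_self)

/-! ## §1  Calculus: a `C²` function constant along a line has vanishing second derivative along it -/

section Calculus

variable {n : ℕ}

/-- **A `C²` function that is constant along the line `t ↦ x + t•w` near `t = 0` has `D²g(x)(w,w) = 0`**: the first
derivative along the line vanishes near `0` (uniqueness of derivatives against the constant), hence so does its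
derivative at `0`, which is `D²g(x)(w,w)` (`T4CubeConvexExtension.hasDerivAt_fderiv_line`). [folklore] -/
theorem fderiv_fderiv_eq_zero_of_eventually_const {g : (Fin n → ℝ) → ℝ} (hg : ContDiff ℝ 2 g) {x w : Fin n → ℝ}
    (h : ∀ᶠ t in 𝓝 (0 : ℝ), g (x + t • w) = g x) : fderiv ℝ (fderiv ℝ g) x w w = 0 := by
  have hd : Differentiable ℝ g := hg.differentiable (by norm_num)
  have h1 : ∀ᶠ t in 𝓝 (0 : ℝ), fderiv ℝ g (x + t • w) w = 0 := by
    filter_upwards [h.eventually_nhds] with t ht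
    have hl : HasDerivAt (fun s : ℝ => x + s • w) w t := by
      simpa using ((hasDerivAt_id t).smul_const w).const_add x
    have hc : HasDerivAt (fun s : ℝ => g (x + s • w)) (fderiv ℝ g (x + t • w) w) t :=
      (hd (x + t • w)).hasFDerivAt.comp_hasDerivAt t hl
    have hz : HasDerivAt (fun s : ℝ => g (x + s • w)) 0 t :=
      (hasDerivAt_const t (g x)).congr_of_eventuallyEq ht
    exact hc.unique hz
  have h2 : HasDerivAt (fun t : ℝ => fderiv ℝ g (x + t • w) w) 0 0 :=
    (hasDerivAt_const (0 : ℝ) (0 : ℝ)).congr_of_eventuallyEq h1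
  exact (hasDerivAt_fderiv_line hg x w).unique h2

/-- **A window Hessian bound at a flat point is non-positive**: `HessianBoundOn g K μ`, `x ∈ K`, `w ≠ 0` and `g`
constant along `t ↦ x + t•w` near `0` give `μ ≤ 0` (`μ|w|² ≤ D²g(x)(w,w) = 0`, `|w|² > 0` by Mathlib's
`Matrix.dotProduct_star_self_pos_iff`). [folklore] -/
theorem hessianBoundOn_nonpos_of_flat {g : (Fin n → ℝ) → ℝ} (hg : ContDiff ℝ 2 g) {K : Set (Fin n → ℝ)} {lam : ℝ}
    (hB : HessianBoundOn g K lam) {x w : Fin n → ℝ} (hx : x ∈ K) (hw : w ≠ 0)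
    (h : ∀ᶠ t in 𝓝 (0 : ℝ), g (x + t • w) = g x) : lam ≤ 0 := by
  have h1 := (hessianBoundOn_iff_fderiv hg).1 hB x hx w
  rw [fderiv_fderiv_eq_zero_of_eventually_const hg h] at h1
  have hpos : 0 < w ⬝ᵥ w := by simpa using Matrix.dotProduct_star_self_pos_iff.2 hw
  exact le_of_mul_le_mul_right (by rwa [zero_mul]) hpos

/-- `0 ∈ [-S,S]ⁿ` for `S ≥ 0`. [folklore] -/
theorem zero_mem_cube {S : ℝ} (hS : 0 ≤ S) : (0 : Fin n → ℝ) ∈ cube n S :=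
  mem_cube_iff.2 fun _ => by simpa using hS

/-- For `S > 0` the line `t ↦ t•W` stays in `[-S,S]ⁿ` for `t` near `0`. [folklore] -/
theorem eventually_smul_mem_cube {S : ℝ} (hS : 0 < S) (W : Fin n → ℝ) :
    ∀ᶠ t in 𝓝 (0 : ℝ), t • W ∈ cube n S := by
  have hc : Continuous fun t : ℝ => t • W := continuous_id.smul continuous_const
  have hn : cube n S ∈ 𝓝 ((fun t : ℝ => t • W) 0) := by
    have h0 : (fun t : ℝ => t • W) 0 = 0 := zero_smul ℝ W
    rw [h0]
    exact cube_mem_nhds (half_lt_self hS) (zero_mem_cube (half_pos hS).le)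
  exact hc.continuousAt.preimage_mem_nhds hn

/-- `gnoKappa S ≤ 4` (`= 4` at `S = 0`). [folklore] -/
theorem gnoKappa_le_four (S : ℝ) : gnoKappa S ≤ 4 := by
  rw [gnoKappa_eq, div_le_iff₀ (by positivity)]
  nlinarith [sq_nonneg S, sq_nonneg (S ^ 2)]

end Calculus

/-! ## §2  Gauge invariance of the Wilson action (B7 (8) telescoped around (9)), for every `GaugeGroup` -/

section Invariance

variable {P : Params} {j : ℕ} {G : Type*} [GaugeGroup G]

/-- `U^u(∂p) = u(x) U(∂p) u(x)⁻¹`, `x = p₋`: the inner factors telescope (`Site.shift_comm`). [folklore] -/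
theorem plaqHol_gaugeAct (u : GaugeTransf P j G) (U : GaugeField P j G) (p : Plaq P j) :
    GaugeField.plaqHol (GaugeField.gaugeAct u U) p = u p.src * GaugeField.plaqHol U p * (u p.src)⁻¹ := by
  simp only [GaugeField.plaqHol, GaugeField.gaugeAct, PBond.tgt, Site.shift_comm p.src p.ν p.μ]
  group

/-- **`A_w(U^u) = A_w(U)`** (`GaugeGroup.reTr_conj`). [folklore] -/
theorem wilsonAction_gaugeAct (w : ℝ) (u : GaugeTransf P j G) (U : GaugeField P j G) :
    wilsonAction w (GaugeField.gaugeAct u U) = wilsonAction w U := by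
  unfold wilsonAction
  exact Finset.sum_congr rfl fun p _ => by rw [plaqHol_gaugeAct, GaugeGroup.reTr_conj]

/-- The Wilson action is a gauge-invariant density. [folklore] -/
theorem gaugeInvariant_wilsonAction (w : ℝ) :
    GaugeField.GaugeInvariant (fun U : GaugeField P j G => wilsonAction w U) :=
  fun u U => wilsonAction_gaugeAct w u U

/-- … and so is the `k = 0` Wilson exponent `U ↦ −β·A_w(U)` (the `h` of `T4WilsonStapleDeviation`). [folklore] -/
theorem gaugeInvariant_wilsonExponent (β w : ℝ) :
    GaugeField.GaugeInvariant (fun U : GaugeField P j G => -β * wilsonAction w U) :=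
  fun u U => by simp only [wilsonAction_gaugeAct]

/-- Post-composition preserves gauge invariance. [folklore] -/
theorem gaugeInvariant_comp {α γ : Type*} {F : GaugeField P j G → α} (hF : GaugeField.GaugeInvariant F) (φ : α → γ) :
    GaugeField.GaugeInvariant (fun U => φ (F U)) :=
  fun u U => by simp only [hF u U]

end Invariance

/-! ## §3  Quaternion bookkeeping: conjugating a gnomonic point rotates its coordinate; the antipodal coordinate inverts -/

section Quaternion

/-- `su2Quat : SU(2) → ℍ` is injective (`quatToSU2 ∘ su2Quat = id`). [folklore] -/
theorem su2Quat_injective : Function.Injective (su2Quat : SU2 → ℍ) := fun U V h => by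
  rw [← quatToSU2_su2Quat U, h, quatToSU2_su2Quat]

/-- `Re (1, v) = 1`. [folklore] -/
theorem re_gnomonicQuat (v : Fin 3 → ℝ) : (gnomonicQuat v).re = 1 := rfl

/-- THE ROTATED COORDINATE `R_q v := Im(q̄ · (1,v) · q) ∈ ℝ³` (for a unit quaternion `q` this is the rotation of `ℝ³`
by `q⁻¹`, read on the gnomonic coordinate). [folklore] -/
def rotVec (q : ℍ) (v : Fin 3 → ℝ) : Fin 3 → ℝ := imVec (star q * gnomonicQuat v * q)

/-- **`q̄ · (1,v) · q = (1, R_q v)`** for `|q| = 1` (`Re(q̄ m q) = |q|² Re m`). [folklore] -/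
theorem star_mul_gnomonicQuat_mul {q : ℍ} (hq : ‖q‖ = 1) (v : Fin 3 → ℝ) :
    star q * gnomonicQuat v * q = gnomonicQuat (rotVec q v) := by
  have hn : Quaternion.normSq q = 1 := by rw [Quaternion.normSq_eq_norm_mul_self, hq, mul_one]
  have hcomm : ∀ p r : ℍ, (p * r).re = (r * p).re := fun p r => by simp only [Quaternion.re_mul]; ring
  have hre : (star q * gnomonicQuat v * q).re = 1 := by
    rw [hcomm, ← mul_assoc, Quaternion.self_mul_star, hn, Quaternion.coe_one, one_mul, re_gnomonicQuat]
  ext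
  · rw [hre, re_gnomonicQuat]
  · rfl
  · rfl
  · rfl

/-- `R_q` is homogeneous: `R_q (τ v) = τ R_q v` (the part of `q̄ (1, τv) q` not carrying `τ` is `q̄ q`, real). [folklore] -/
theorem rotVec_smul (q : ℍ) (τ : ℝ) (v : Fin 3 → ℝ) : rotVec q (τ • v) = τ • rotVec q v := by
  ext i
  fin_cases i <;>
  · simp [rotVec, imVec, gnomonicQuat, Quaternion.re_mul, Quaternion.imI_mul, Quaternion.imJ_mul, Quaternion.imK_mul,
      Quaternion.re_star, Quaternion.imI_star, Quaternion.imJ_star, Quaternion.imK_star]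
    ring

/-- `|(1, R_q v)| = |(1, v)|` for `|q| = 1`. [folklore] -/
theorem norm_gnomonicQuat_rotVec {q : ℍ} (hq : ‖q‖ = 1) (v : Fin 3 → ℝ) :
    ‖gnomonicQuat (rotVec q v)‖ = ‖gnomonicQuat v‖ := by
  rw [← star_mul_gnomonicQuat_mul hq, norm_mul, norm_mul, Quaternion.norm_star, hq, one_mul, mul_one]

/-- **CONJUGATION ROTATES THE GNOMONIC COORDINATE**: `g · P(1, R_{su2Quat g} v) = P(1, v) · g` in `SU(2)`. [folklore] -/
theorem mul_gnoPoint_rotVec (g : SU2) (v : Fin 3 → ℝ) : g * gnoPoint (rotVec (su2Quat g) v) = gnoPoint v * g := by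
  have hq : ‖su2Quat g‖ = 1 := norm_su2Quat g
  apply su2Quat_injective
  rw [su2Quat_mul, su2Quat_mul, su2Quat_gnoPoint, su2Quat_gnoPoint, norm_gnomonicQuat_rotVec hq,
    ← star_mul_gnomonicQuat_mul hq, mul_smul_comm, smul_mul_assoc, ← mul_assoc, ← mul_assoc,
    Quaternion.self_mul_star, normSq_su2Quat, Quaternion.coe_one, one_mul]

/-- `(1, v)‾ = (1, −v)`. [folklore] -/
theorem star_gnomonicQuat (v : Fin 3 → ℝ) : star (gnomonicQuat v) = gnomonicQuat (-v) := by
  ext <;> simp [gnomonicQuat]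

/-- `|(1, −v)| = |(1, v)|`. [folklore] -/
theorem norm_gnomonicQuat_neg (v : Fin 3 → ℝ) : ‖gnomonicQuat (-v)‖ = ‖gnomonicQuat v‖ := by
  rw [← star_gnomonicQuat, Quaternion.norm_star]

/-- **THE ANTIPODAL COORDINATE IS THE INVERSE**: `P(1, −v) = P(1, v)⁻¹`. [folklore] -/
theorem gnoPoint_neg (v : Fin 3 → ℝ) : gnoPoint (-v) = (gnoPoint v)⁻¹ := by
  apply su2Quat_injective
  rw [su2Quat_inv, su2Quat_gnoPoint, su2Quat_gnoPoint, norm_gnomonicQuat_neg]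
  ext <;> simp [gnomonicQuat]

end Quaternion

/-! ## §4  The star of a site, the one-site gauge transformation, and the gauge direction in the chart -/

section Star

variable {P : Params} {j : ℕ}

/-- **THE FIBRE CONTAINS THE STAR OF `x₀`**: every bond leaving or entering `x₀` belongs to `s`. [folklore] -/
def ContainsStar (s : Finset (PBond P j)) (x₀ : Site P j) : Prop :=
  ∀ b : PBond P j, b.src = x₀ ∨ b.tgt = x₀ → b ∈ s

/-- The full-lattice fibre contains every star (the hypothesis is inhabited). [folklore] -/
theorem containsStar_univ (x₀ : Site P j) : ContainsStar (Finset.univ : Finset (PBond P j)) x₀ :=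
  fun b _ => Finset.mem_univ b

/-- The direction `e₀` (`d ≥ 1`, `Params.hd`). [folklore] -/
def dir₀ (P : Params) : Fin P.d := ⟨0, P.hd⟩

/-- The bond `⟨x₀, x₀ + e₀⟩` leaving `x₀`. [folklore] -/
def outBond (x₀ : Site P j) : PBond P j := ⟨x₀, dir₀ P⟩

/-- The bond `⟨x₀ − e₀, x₀⟩` entering `x₀`. [folklore] -/
def inBond (x₀ : Site P j) : PBond P j := ⟨x₀.unshift (dir₀ P), dir₀ P⟩

/-- `(inBond x₀)₊ = x₀` (the tree's `Site.shift_unshift`, `T4Covariance`). [folklore] -/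
theorem inBond_tgt (x₀ : Site P j) : (inBond x₀).tgt = x₀ := Site.shift_unshift x₀ (dir₀ P)

/-- `(inBond x₀)₋ ≠ x₀` (`T4WilsonLinkAffine.shift_ne_self`). [folklore] -/
theorem inBond_src_ne (x₀ : Site P j) : (inBond x₀).src ≠ x₀ := fun h => by
  have h1 := shift_ne_self (x₀.unshift (dir₀ P)) (dir₀ P)
  rw [Site.shift_unshift] at h1
  exact h1 h.symm

/-- The two star bonds `⟨x₀, x₀ + e₀⟩`, `⟨x₀ − e₀, x₀⟩` are distinct. [folklore] -/
theorem outBond_ne_inBond (x₀ : Site P j) : outBond x₀ ≠ inBond x₀ :=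
  fun h => inBond_src_ne x₀ (congrArg PBond.src h).symm

/-- THE ONE-SITE GAUGE TRANSFORMATION `x₀ ↦ k`, `y ↦ 1` (`y ≠ x₀`). [folklore] -/
def siteTransf (x₀ : Site P j) (k : SU2) : GaugeTransf P j SU2 := fun y => if y = x₀ then k else 1

/-- Its value at `x₀`. [folklore] -/
theorem siteTransf_of_eq {x₀ y : Site P j} (k : SU2) (h : y = x₀) : siteTransf x₀ k y = k := if_pos h

/-- Its value off `x₀`. [folklore] -/
theorem siteTransf_of_ne {x₀ y : Site P j} (k : SU2) (h : y ≠ x₀) : siteTransf x₀ k y = 1 := if_neg h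

/-- The gauge action of the one-site transformation, bond by bond (a bond never both leaves and enters `x₀`,
`shift_ne_self`). [folklore] -/
theorem gaugeAct_siteTransf (x₀ : Site P j) (k : SU2) (U : GaugeField P j SU2) (b : PBond P j) :
    GaugeField.gaugeAct (siteTransf x₀ k) U b =
      if b.src = x₀ then k * U b else if b.tgt = x₀ then U b * k⁻¹ else U b := by
  unfold GaugeField.gaugeAct
  by_cases hsrc : b.src = x₀
  · have htgt : b.tgt ≠ x₀ := fun h => shift_ne_self b.src b.dir (h.trans hsrc.symm)
    rw [if_pos hsrc, siteTransf_of_eq k hsrc, siteTransf_of_ne k htgt, inv_one, mul_one]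
  · by_cases htgt : b.tgt = x₀
    · rw [if_neg hsrc, if_pos htgt, siteTransf_of_ne k hsrc, siteTransf_of_eq k htgt, one_mul]
    · rw [if_neg hsrc, if_neg htgt, siteTransf_of_ne k hsrc, siteTransf_of_ne k htgt, inv_one, one_mul, mul_one]

variable {s : Finset (PBond P j)} {u₀ : GaugeField P j SU2} {n : ℕ} {e : ↥s × Fin 3 ≃ Fin n} {x₀ : Site P j}
  {X : Fin 3 → ℝ}

/-- THE BLOCK OF THE GAUGE DIRECTION at the bond `b`: `R_{u₀(b)} X` if `b` leaves `x₀`, `−X` if `b` enters `x₀`,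
`0` otherwise. [folklore] -/
def blockDir (u₀ : GaugeField P j SU2) (x₀ : Site P j) (X : Fin 3 → ℝ) (b : PBond P j) : Fin 3 → ℝ :=
  if b.src = x₀ then rotVec (su2Quat (u₀ b)) X else if b.tgt = x₀ then -X else 0

/-- **THE GAUGE DIRECTION** `W ∈ ℝⁿ` in the coordinates `e : s × Fin 3 ≃ Fin n` of the fibre chart: the chart image
of the infinitesimal gauge transformation `X` at `x₀`. [folklore] -/
def gaugeDir (s : Finset (PBond P j)) (u₀ : GaugeField P j SU2) (e : ↥s × Fin 3 ≃ Fin n) (x₀ : Site P j)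
    (X : Fin 3 → ℝ) : Fin n → ℝ :=
  fun k => blockDir u₀ x₀ X ((e.symm k).1 : PBond P j) (e.symm k).2

/-- Its coordinates. [folklore] -/
theorem gaugeDir_apply (b : ↥s) (i : Fin 3) : gaugeDir s u₀ e x₀ X (e (b, i)) = blockDir u₀ x₀ X b i := by
  simp only [gaugeDir, Equiv.symm_apply_apply]

/-- The entering block is `−X`. [folklore] -/
theorem blockDir_inBond : blockDir u₀ x₀ X (inBond x₀) = -X := by
  rw [blockDir, if_neg (inBond_src_ne x₀), if_pos (inBond_tgt x₀)]

/-- **`W ≠ 0` for `X ≠ 0`** on a fibre containing the star (its block at `⟨x₀ − e₀, x₀⟩` is `−X`). [folklore] -/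
theorem gaugeDir_ne_zero (hstar : ContainsStar s x₀) (hX : X ≠ 0) : gaugeDir s u₀ e x₀ X ≠ 0 := by
  obtain ⟨i, hi⟩ := Function.ne_iff.1 hX
  have hb : inBond x₀ ∈ s := hstar _ (Or.inr (inBond_tgt x₀))
  intro hW
  have h1 := congr_fun hW (e (⟨inBond x₀, hb⟩, i))
  rw [gaugeDir_apply, Pi.zero_apply] at h1
  change blockDir u₀ x₀ X (inBond x₀) i = 0 at h1
  rw [blockDir_inBond, Pi.neg_apply, neg_eq_zero] at h1
  exact hi h1

/-- The fibre chart along the line `τ•W`, block by block: `u₀(b) · P(1, τ • blockDir b)`. [folklore] -/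
theorem gnoFibreChart_smul_gaugeDir (τ : ℝ) (b : ↥s) :
    gnoFibreChart s u₀ e (τ • gaugeDir s u₀ e x₀ X) b = u₀ b * gnoPoint (τ • blockDir u₀ x₀ X b) := by
  have hfun : (fun i => (τ • gaugeDir s u₀ e x₀ X) (e (b, i))) = τ • blockDir u₀ x₀ X b := by
    funext i
    simp only [Pi.smul_apply, gaugeDir_apply]
  show gnoChart (u₀ b) (fun i => (τ • gaugeDir s u₀ e x₀ X) (e (b, i))) = _
  rw [hfun]
  rfl

/-- … which is the gauge action of `siteTransf x₀ (P(1, τX))` on that link (`mul_gnoPoint_rotVec`, `gnoPoint_neg`,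
`gnoPoint_zero`). [folklore] -/
theorem mul_gnoPoint_smul_blockDir (τ : ℝ) (b : PBond P j) :
    u₀ b * gnoPoint (τ • blockDir u₀ x₀ X b) =
      if b.src = x₀ then gnoPoint (τ • X) * u₀ b else if b.tgt = x₀ then u₀ b * (gnoPoint (τ • X))⁻¹ else u₀ b := by
  unfold blockDir
  split_ifs with hsrc htgt
  · rw [← rotVec_smul, mul_gnoPoint_rotVec]
  · rw [smul_neg, gnoPoint_neg]
  · rw [smul_zero, gnoPoint_zero, mul_one]

variable [DecidableEq (PBond P j)]

/-- A fibre containing a star has at least two links. [folklore] -/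
theorem two_le_card_of_containsStar {s : Finset (PBond P j)} {x₀ : Site P j} (h : ContainsStar s x₀) : 2 ≤ s.card := by
  rw [← Finset.card_pair (outBond_ne_inBond x₀)]
  refine Finset.card_le_card fun b hb => ?_
  rcases Finset.mem_insert.1 hb with rfl | hb
  · exact h _ (Or.inl rfl)
  · rw [Finset.mem_singleton.1 hb]
    exact h _ (Or.inr (inBond_tgt x₀))

/-- **A ONE-LINK FIBRE NEVER CONTAINS A STAR** — the one-link results of the lineage are outside the scope of the §5
verdicts. [folklore] -/
theorem not_containsStar_singleton (b : PBond P j) (x₀ : Site P j) : ¬ ContainsStar ({b} : Finset (PBond P j)) x₀ :=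
  fun h => by
    have h2 := two_le_card_of_containsStar h
    rw [Finset.card_singleton] at h2
    omega

/-- **THE CHART LINE IS THE GAUGE ORBIT**: on a fibre containing the star of `x₀`,
`u₀ ←ₛ φ(τ•W) = u₀^{g_τ}`, `g_τ = siteTransf x₀ (P(1, τX))`, for every `τ ∈ ℝ`. [folklore] -/
theorem updateFinset_gnoFibreChart_gaugeDir (hstar : ContainsStar s x₀) (τ : ℝ) :
    updateFinset u₀ s (gnoFibreChart s u₀ e (τ • gaugeDir s u₀ e x₀ X)) =
      GaugeField.gaugeAct (siteTransf x₀ (gnoPoint (τ • X))) u₀ := by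
  funext b
  rw [gaugeAct_siteTransf]
  by_cases hb : b ∈ s
  · rw [Function.updateFinset, dif_pos hb]
    exact (gnoFibreChart_smul_gaugeDir τ ⟨b, hb⟩).trans (mul_gnoPoint_smul_blockDir τ b)
  · have hsrc : b.src ≠ x₀ := fun h => hb (hstar b (Or.inl h))
    have htgt : b.tgt ≠ x₀ := fun h => hb (hstar b (Or.inr h))
    rw [Function.updateFinset, dif_neg hb, if_neg hsrc, if_neg htgt]

/-- **GAUGE-INVARIANT EXPONENTS ARE CONSTANT ALONG THE CHART LINE `τ•W`.** [folklore] -/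
theorem apply_line_eq_of_gaugeInvariant {h : Density P j SU2} (hinv : GaugeField.GaugeInvariant h)
    (hstar : ContainsStar s x₀) (τ : ℝ) :
    h (updateFinset u₀ s (gnoFibreChart s u₀ e (τ • gaugeDir s u₀ e x₀ X))) = h u₀ := by
  rw [updateFinset_gnoFibreChart_gaugeDir hstar, hinv]

/-! ## §5  The verdicts: a representative agreeing with a gauge-invariant exponent on the window is flat along `W` at
the centre; its window Hessian modulus is `≤ 0`; the plug modulus is `≤ gnoKappa S' ≤ 4`, `β`-free -/

/-- A `C²`… in fact ANY function `g` agreeing with `−h(u₀ ←ₛ φ(·))` on `[-S,S]ⁿ` (`S > 0`) is constant along `t ↦ t•W`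
near `t = 0`. [folklore] -/
theorem rep_eventually_const {h : Density P j SU2} (hinv : GaugeField.GaugeInvariant h) (hstar : ContainsStar s x₀)
    {S : ℝ} (hS : 0 < S) {g : (Fin n → ℝ) → ℝ}
    (agree : ∀ x ∈ cube n S, g x = -h (updateFinset u₀ s (gnoFibreChart s u₀ e x))) :
    ∀ᶠ t in 𝓝 (0 : ℝ), g (0 + t • gaugeDir s u₀ e x₀ X) = g 0 := by
  filter_upwards [eventually_smul_mem_cube hS (gaugeDir s u₀ e x₀ X)] with t ht
  have h0 : g 0 = -h u₀ := by
    rw [agree 0 (zero_mem_cube hS.le), ← zero_smul ℝ (gaugeDir s u₀ e x₀ X),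
      apply_line_eq_of_gaugeInvariant hinv hstar]
  rw [zero_add, agree _ ht, apply_line_eq_of_gaugeInvariant hinv hstar, h0]

/-- **THE FLAT DIRECTION**: `D²g(0)(W, W) = 0` for every `C²` representative `g` of a gauge-invariant exponent on a
fibre containing a star. [folklore] -/
theorem fderiv_fderiv_rep_gaugeDir {h : Density P j SU2} (hinv : GaugeField.GaugeInvariant h)
    (hstar : ContainsStar s x₀) {S : ℝ} (hS : 0 < S) {g : (Fin n → ℝ) → ℝ} (hg : ContDiff ℝ 2 g)
    (agree : ∀ x ∈ cube n S, g x = -h (updateFinset u₀ s (gnoFibreChart s u₀ e x))) :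
    fderiv ℝ (fderiv ℝ g) 0 (gaugeDir s u₀ e x₀ X) (gaugeDir s u₀ e x₀ X) = 0 :=
  fderiv_fderiv_eq_zero_of_eventually_const hg (rep_eventually_const hinv hstar hS agree)

/-- **VERDICT (N1, negative edge)**: on a fibre containing the star of a site, a window Hessian bound
`HessianBoundOn g K μ` (`0 ∈ K`) of a `C²` representative of ANY gauge-invariant exponent has `μ ≤ 0`. [folklore] -/
theorem windowModulus_nonpos_of_gaugeInvariant {h : Density P j SU2} (hinv : GaugeField.GaugeInvariant h)
    (hstar : ContainsStar s x₀) {S : ℝ} (hS : 0 < S) {g : (Fin n → ℝ) → ℝ} (hg : ContDiff ℝ 2 g)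
    (agree : ∀ x ∈ cube n S, g x = -h (updateFinset u₀ s (gnoFibreChart s u₀ e x))) {K : Set (Fin n → ℝ)}
    (hK : (0 : Fin n → ℝ) ∈ K) {mu : ℝ} (hB : HessianBoundOn g K mu) : mu ≤ 0 :=
  hessianBoundOn_nonpos_of_flat hg hB hK (gaugeDir_ne_zero (X := fun _ => 1) hstar (by simp [funext_iff]))
    (rep_eventually_const hinv hstar hS agree)

/-- **THE PLUG MODULUS ON A STAR-CONTAINING FIBRE IS `β`-FREE**: in the binder shape `hS hSS' hg₀ hB₀ agree₀` of
`T4CubeConvexExtension.mem_respDom_of_gnoChart_local`, for a gauge-invariant `h`: `μ ≤ 0`, hence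
`λ = gnoKappa S' + μ ≤ gnoKappa S' ≤ 4`. [folklore] -/
theorem plug_modulus_le_of_gaugeInvariant {h : Density P j SU2} (hinv : GaugeField.GaugeInvariant h)
    (hstar : ContainsStar s x₀) {S S' : ℝ} (hS : 0 < S) (hSS' : S < S') {g₀ : (Fin n → ℝ) → ℝ}
    (hg₀ : ContDiff ℝ 2 g₀) {mu : ℝ} (hB₀ : HessianBoundOn g₀ (cube n S') mu)
    (agree₀ : ∀ x ∈ cube n S, g₀ x = -h (updateFinset u₀ s (gnoFibreChart s u₀ e x))) :
    mu ≤ 0 ∧ gnoKappa S' + mu ≤ gnoKappa S' ∧ gnoKappa S' + mu ≤ 4 := by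
  have hmu : mu ≤ 0 :=
    windowModulus_nonpos_of_gaugeInvariant hinv hstar hS hg₀ agree₀ (zero_mem_cube (hS.trans hSS').le) hB₀
  exact ⟨hmu, by linarith, by linarith [gnoKappa_le_four S']⟩

/-- **THE GLOBAL PLUG IS VACUOUS THERE**: `T4CubeChartGnomonic.mem_respDom_of_gnoChart` (binders `hmu : 1/2 < μ`,
`hB₀ : HessianBound g₀ μ`, `agree₀`) cannot be instantiated on a fibre containing a star with a gauge-invariant
exponent — `HessianBound g₀ μ` forces `μ ≤ 0`. [folklore] -/
theorem globalModulus_nonpos_of_gaugeInvariant {h : Density P j SU2} (hinv : GaugeField.GaugeInvariant h)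
    (hstar : ContainsStar s x₀) {S : ℝ} (hS : 0 < S) {g₀ : (Fin n → ℝ) → ℝ} (hg₀ : ContDiff ℝ 2 g₀) {mu : ℝ}
    (hB₀ : HessianBound g₀ mu) (agree₀ : ∀ x ∈ cube n S, g₀ x = -h (updateFinset u₀ s (gnoFibreChart s u₀ e x))) :
    mu ≤ 0 ∧ ¬ (1 / 2 < mu) := by
  have hmu : mu ≤ 0 := windowModulus_nonpos_of_gaugeInvariant hinv hstar hS hg₀ agree₀ (Set.mem_univ _)
    (hB₀.hessianBoundOn Set.univ)
  exact ⟨hmu, fun h => by linarith⟩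

/-- **… IN PARTICULAR FOR THE `k = 0` WILSON EXPONENT** `h = fun U => −β * wilsonAction w U` — every `β`, every `w`,
every reference field `u₀`, every fibre containing a star. [folklore] -/
theorem plug_modulus_le_wilson (β w : ℝ) (hstar : ContainsStar s x₀) {S S' : ℝ} (hS : 0 < S) (hSS' : S < S')
    {g₀ : (Fin n → ℝ) → ℝ} (hg₀ : ContDiff ℝ 2 g₀) {mu : ℝ} (hB₀ : HessianBoundOn g₀ (cube n S') mu)
    (agree₀ : ∀ x ∈ cube n S, g₀ x =
      -(fun U : GaugeField P j SU2 => -β * wilsonAction w U) (updateFinset u₀ s (gnoFibreChart s u₀ e x))) :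
    mu ≤ 0 ∧ gnoKappa S' + mu ≤ 4 := by
  have h := plug_modulus_le_of_gaugeInvariant (gaugeInvariant_wilsonExponent β w) hstar hS hSS' hg₀ hB₀ agree₀
  exact ⟨h.1, h.2.2⟩

/-- NON-VACUITY of the verdict's setting: on the full-lattice fibre (which contains every star) with the constant
representative of the constant exponent, the hypotheses are met and `μ ≤ 0` is forced — e.g. `μ = 0` is attained by
`HessianBoundOn (fun _ => c) K 0`. [folklore] -/
example (c : ℝ) (K : Set (Fin n → ℝ)) : HessianBoundOn (fun _ : Fin n → ℝ => c) K 0 := by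
  rw [hessianBoundOn_iff_fderiv contDiff_const]
  intro x _ w
  simp

end Star

end Literature.MathematicalPhysics.QuantumFieldTheory.Balaban1983to89.T4WilsonGaugeFlatDirection

end
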